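import Mathlib
import Literature.NumberTheory.LFunctions.Zhang2022.SkeletonPartOne
import Literature.NumberTheory.LFunctions.Zhang2022.SkeletonAssembly
import Literature.NumberTheory.LFunctions.Zhang2022.Section4Lemma48
import HarnessLib

/-!
# Zhang (2022), typed skeleton XI: the inner edge of §4 — Lemma 4.8 from Lemmas 4.1, 4.2, 4.4
# and Proposition 2.2 (i), kernel-checked

Topic `Literature/NumberTheory/LFunctions/Zhang2022` (Landau–Siegel audit tree; verdict-neutral).
Y. Zhang, *Discrete mean estimates and the Landau–Siegel zero*, arXiv:2211.02515v1 (2022)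
[Zhang2022LandauSiegel] — **an unrefereed manuscript under adjudication**; the nodes below are the
skeleton's CLAIM nodes (`SkeletonPartOne`), stated not asserted. This file proves ONE EDGE between
them: the manuscript's proof of Lemma 4.8 (§4 p. 23, tex L1282–L1290),

> Lemma 4.8. Assume that `ρ` is a zero of `L(s,ψ)L(s,ψχ)` in `Ω`. Then we have
> `Z̃(ρ,ψ)⁻¹ = −G(ρ,ψ)F(1−ρ,ψ̄) + O(𝓛⁻¹⁰⁰)`.
> Proof. It follows from Lemma 4.4 that `F(ρ,ψ) + Z̃(ρ,ψ)F(1−ρ,ψ̄) ≪ 𝓛⁻¹⁷⁹`. The result follows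
> by multiplying both sides by `Z̃(ρ,ψ)⁻¹G(ρ,ψ)` and applying Lemma 4.1. □

as the kernel theorem `lemma48_of : Prop22i → Lemma41 → Lemma42 → Lemma44 → Lemma48`. The two
inputs the printed proof leaves implicit are made explicit and discharged here: (a) Lemma 4.4 is
stated on `Ω₃ = {1/2 − α < σ < 1 + α, …}` and Lemma 4.1 on `Ω₁ = {1/2 − log𝓛/(100𝓛) < σ < …}`,
neither of which contains `Ω = {0 < σ < 1, …}`; the manuscript introduces Lemma 4.8 as "a result
which is implied in the proof of Proposition 2.2", i.e. it is used for the zeros `ρ ∈ Ω` of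
`ψ ∈ Ψ₁`, which lie on `σ = 1/2` by Proposition 2.2 (i) — so `ρ ∈ Ω₁ ∩ Ω₃`
(`mem_Omega1_of_re_eq_half`, `mem_Omega3_of_re_eq_half`); (b) "(4.5) at `β = 1/2`": on the critical
line `|Z̃(ρ,ψ)| = |Z(ρ,ψ)||Z(ρ,ψχ)| = 1` EXACTLY for `ψ`, `ψχ` primitive (the tree's
`GammaFactor.norm_Zfac_half_eq_one`; `norm_tildeZW_eq_one`), so the factor `|Z̃(ρ)⁻¹|` of the
tree's pointwise algebra `Lemma48.lemma48` is `1`, and Lemma 4.2 supplies the second error term: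
`|Z̃⁻¹ + G F̄| ≤ |G|·C₄₄𝓛⁻¹⁷⁹ + C₄₂𝓛⁻²²⁷ ≤ (C₄₁C₄₄ + C₄₂)𝓛⁻¹⁰⁰` for `𝓛 ≥ 1` (exponent
`100 = min(179 − 79, 227)`, the tree's `Lemma48.exponent_410`).

What is NOT asserted: Lemmas 4.1, 4.2, 4.4, Proposition 2.2 (i) themselves (they remain CLAIM nodes),
hence not Lemma 4.8 as such. Nothing about Theorems 1–2 of the source is stated or implied; nothing
here bears on the cell's verdict on (8.24).

## References

* Y. Zhang, arXiv:2211.02515v1 (2022), §4 Lemmas 4.1, 4.2, 4.4, 4.8, (4.5), Proposition 2.2 (i).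
  [cite: Zhang2022LandauSiegel, §4 Lemma 4.8]
-/

noncomputable section

open Complex Real

namespace Literature.NumberTheory.LFunctions.Zhang2022.Skeleton

variable {D : ℕ} [NeZero D] (χ : DirichletCharacter ℂ D)

/-! ## The implicit inputs of the proof of Lemma 4.8 -/

omit [NeZero D] in
/-- `α = π/log P > 0` for `D ≥ 3` ((2.10); `log P = 𝓛⁹` by (2.6)). [cite: Zhang2022LandauSiegel, §2 (2.10)] -/
theorem alpha_pos (hD : 3 ≤ D) : 0 < alpha D := by
  rw [alpha, bigP, Real.log_exp]
  exact div_pos Real.pi_pos (pow_pos (by linarith [one_lt_ell hD]) _)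

/-- Points of `Ω` which are zeros of `L(s,ψ)L(s,ψχ)` have positive imaginary part
(`2πt₀ − 𝓛₁ − 2 > 0` for `D ≥ 3`). [cite: Zhang2022LandauSiegel, §2 (2.7)] -/
theorem im_pos_of_mem_prodZeroSetOmega (hD : 3 ≤ D) {x : Chr D} {ρ : ℂ}
    (h : ρ ∈ prodZeroSetOmega χ x) : 0 < ρ.im := by
  obtain ⟨⟨-, him⟩, -⟩ := h
  rw [Complex.sub_im, s0_im] at him
  have h1 : 1 < ell D := one_lt_ell hD
  have hℓ1 : 1 ≤ ell1 D := one_le_pow₀ h1.le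
  have hmono : ell1 D ≤ t0 D := pow_le_pow_right₀ h1.le (by norm_num)
  have hπ : (3 : ℝ) < π := Real.pi_gt_three
  have := (abs_lt.mp him).1
  nlinarith

omit [NeZero D] in
/-- A point of `Ω` on the critical line lies in `Ω₁` of Lemma 4.1 (`D ≥ 3`, so `log 𝓛 > 0`).
[cite: Zhang2022LandauSiegel, §4 Lemma 4.1] -/
theorem mem_Omega1_of_re_eq_half (hD : 3 ≤ D) {ρ : ℂ} (hΩ : ρ ∈ Omega D) (hre : ρ.re = 1 / 2) :
    ρ ∈ Omega1 D := by
  obtain ⟨-, him⟩ := hΩ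
  rw [Complex.sub_im, s0_im] at him
  have h1 : 1 < ell D := one_lt_ell hD
  have hpos : 0 < Real.log (ell D) / (100 * ell D) :=
    div_pos (Real.log_pos h1) (by linarith)
  rw [Omega1, Lemma43.mem_Omega1_iff]
  refine ⟨by linarith, by linarith, by linarith⟩

omit [NeZero D] in
/-- A point of `Ω` on the critical line lies in `Ω₃` of Lemma 4.4 (`D ≥ 3`, so `α > 0`).
[cite: Zhang2022LandauSiegel, §4 Lemma 4.4] -/
theorem mem_Omega3_of_re_eq_half (hD : 3 ≤ D) {ρ : ℂ} (hΩ : ρ ∈ Omega D) (hre : ρ.re = 1 / 2) :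
    ρ ∈ Omega3 D := by
  obtain ⟨-, him⟩ := hΩ
  rw [Complex.sub_im, s0_im] at him
  have hα : 0 < alpha D := alpha_pos hD
  refine ⟨by linarith, by linarith, by linarith⟩

/-- **"(4.5) at `β = 1/2`"**, EXACT: `|Z̃(ρ,ψ)| = 1` for `Re ρ = 1/2`, `Im ρ > 0`, `ψχ` primitive
(`ψ` is primitive as a member of `Ψ`). [cite: Zhang2022LandauSiegel, §4 (4.5)] -/
theorem norm_tildeZW_eq_one {x : Chr D} (hprim : (psiChi χ x).IsPrimitive) {ρ : ℂ}
    (hre : ρ.re = 1 / 2) (him : 0 < ρ.im) : ‖tildeZW χ x ρ‖ = 1 := by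
  have hρ : ρ = 1 / 2 + (ρ.im : ℂ) * I := Complex.ext (by simp [hre]) (by simp)
  rw [tildeZW, GammaFactor.tildeZ_def, norm_mul, hρ, GammaFactor.norm_Zfac_half_eq_one x.prim him,
    GammaFactor.norm_Zfac_half_eq_one hprim him, one_mul]

/-! ## The edge -/

/-- **Lemma 4.8 from Lemmas 4.1, 4.2, 4.4 and Proposition 2.2 (i)** — the manuscript's proof of
Lemma 4.8 (§4 p. 23), kernel-checked as an implication between the skeleton's CLAIM nodes, with
the constant `C₄₈ = C₄₁⁺C₄₄⁺ + C₄₂⁺` (`x⁺ = max(x,0)`): at a zero `ρ ∈ Ω` of `L(s,ψ)L(s,ψχ)`,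
`ψ ∈ Ψ₁`, one has `Re ρ = 1/2` (Prop. 2.2 (i)), so Lemma 4.4 applies at `ρ` (`ρ ∈ Ω₃`) and gives
`|F + Z̃F̄| ≤ C₄₄𝓛⁻¹⁷⁹`; Lemma 4.1 (`ρ ∈ Ω₁`) gives `|G| ≤ C₄₁𝓛⁷⁹`, Lemma 4.2 gives
`|FG − 1| ≤ C₄₂𝓛⁻²²⁷`, `|Z̃(ρ)| = 1`; the tree's `Lemma48.lemma48` assembles
`|Z̃⁻¹ + GF̄| ≤ C₄₁C₄₄𝓛⁻¹⁰⁰ + C₄₂𝓛⁻²²⁷ ≤ C₄₈𝓛⁻¹⁰⁰`. [cite: Zhang2022LandauSiegel, §4 Lemma 4.8] -/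
theorem lemma48_of (h22i : Prop22i) (h41 : Lemma41) (h42 : Lemma42) (h44 : Lemma44) :
    Lemma48 := by
  obtain ⟨C₁, h41⟩ := h41
  obtain ⟨C₂, h42⟩ := h42
  obtain ⟨C₄, h44⟩ := h44
  obtain ⟨D₀, hD₀⟩ := ((h22i.and h41).and h42).and h44
  refine ⟨max C₁ 0 * max C₄ 0 + max C₂ 0, max D₀ 3, fun D _ χ hD hq hp x hx ρ hρ => ?_⟩
  have hD3 : 3 ≤ D := le_trans (le_max_right _ _) hD
  obtain ⟨⟨⟨e22, e41⟩, e42⟩, e44⟩ := hD₀ D χ (le_trans (le_max_left _ _) hD) hq hp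
  have hre : ρ.re = 1 / 2 := e22 x hx ρ hρ
  have him : 0 < ρ.im := im_pos_of_mem_prodZeroSetOmega χ hD3 hρ
  have hΩ1 : ρ ∈ Omega1 D := mem_Omega1_of_re_eq_half hD3 hρ.1 hre
  have hΩ3 : ρ ∈ Omega3 D := mem_Omega3_of_re_eq_half hD3 hρ.1 hre
  have hprim : (psiChi χ x).IsPrimitive := psiChiPrimitive_holds D χ x hD3 hp
  have hZ1 : ‖tildeZW χ x ρ‖ = 1 := norm_tildeZW_eq_one χ hprim hre him
  have hZ : tildeZW χ x ρ ≠ 0 := by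
    intro h; rw [h, norm_zero] at hZ1; exact zero_ne_one hZ1
  have b41 := e41 x hx ρ hΩ1
  have b42 := e42 x hx ρ hΩ1
  have b44 := e44 x hx ρ hΩ3
  have hLL : LL χ x ρ = 0 := hρ.2
  have b44' : ‖Fpoly χ x ρ + tildeZW χ x ρ * FpolyBar χ x (1 - ρ)‖ ≤ C₄ * (ell D ^ 179)⁻¹ := by
    have hrw : LL χ x ρ - Fpoly χ x ρ - tildeZW χ x ρ * FpolyBar χ x (1 - ρ)
        = -(Fpoly χ x ρ + tildeZW χ x ρ * FpolyBar χ x (1 - ρ)) := by rw [hLL]; ring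
    rwa [hrw, norm_neg] at b44
  have key := Lemma48.lemma48 hZ b44' b42
  rw [norm_inv, hZ1, inv_one, one_mul] at key
  have hℓ : 1 < ell D := one_lt_ell hD3
  have hℓ0 : 0 < ell D := by linarith
  have hG : ‖Gpoly χ x ρ‖ ≤ max C₁ 0 * ell D ^ 79 :=
    calc ‖Gpoly χ x ρ‖ ≤ ‖Fpoly χ x ρ‖ + ‖Gpoly χ x ρ‖ := le_add_of_nonneg_left (norm_nonneg _)
      _ ≤ C₁ * ell D ^ 79 := b41
      _ ≤ max C₁ 0 * ell D ^ 79 := by gcongr; exact le_max_left _ _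
  have h79 : ell D ^ 79 * (ell D ^ 179)⁻¹ = (ell D ^ 100)⁻¹ := by
    field_simp
  have h227 : (ell D ^ 227)⁻¹ ≤ (ell D ^ 100)⁻¹ :=
    inv_anti₀ (pow_pos hℓ0 _) (pow_le_pow_right₀ hℓ.le (by norm_num))
  calc ‖(tildeZW χ x ρ)⁻¹ + Gpoly χ x ρ * FpolyBar χ x (1 - ρ)‖
      ≤ ‖Gpoly χ x ρ‖ * (C₄ * (ell D ^ 179)⁻¹) + C₂ * (ell D ^ 227)⁻¹ := key
    _ ≤ ‖Gpoly χ x ρ‖ * (max C₄ 0 * (ell D ^ 179)⁻¹) + max C₂ 0 * (ell D ^ 227)⁻¹ := by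
        gcongr
        · exact le_max_left _ _
        · exact le_max_left _ _
    _ ≤ (max C₁ 0 * ell D ^ 79) * (max C₄ 0 * (ell D ^ 179)⁻¹) + max C₂ 0 * (ell D ^ 227)⁻¹ := by
        gcongr
    _ = (max C₁ 0 * max C₄ 0) * (ell D ^ 79 * (ell D ^ 179)⁻¹) + max C₂ 0 * (ell D ^ 227)⁻¹ := by
        ring
    _ ≤ (max C₁ 0 * max C₄ 0) * (ell D ^ 100)⁻¹ + max C₂ 0 * (ell D ^ 100)⁻¹ := by
        rw [h79]
        gcongr
    _ = (max C₁ 0 * max C₄ 0 + max C₂ 0) * (ell D ^ 100)⁻¹ := by ring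

end Literature.NumberTheory.LFunctions.Zhang2022.Skeleton
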